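import Literature.AlgebraicGeometry.ShimuraVarieties.UnitaryCanonicalModelDescentToIntersection
import Literature.AlgebraicGeometry.ShimuraVarieties.UnitaryShimuraComplexGaloisTwist
import Literature.AlgebraicGeometry.ShimuraVarieties.UnitaryShimuraReciprocityOfGaloisTwist
import Literature.AlgebraicGeometry.ShimuraVarieties.UnitaryShimuraFormProperties
import Literature.AlgebraicGeometry.Motives.GaloisDescentDatumOfTwistsAction
import Literature.AlgebraicGeometry.Motives.GaloisDescentDatumOfTwistsForm
import Literature.FieldTheory.Galois.IntersectionHull
import HarnessLib

/-!
# [Deligne 1971, Prop. 5.10] read at the unitary tower: descent of models with Shimura reciprocity to the intersection of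
# their base fields — the row I-6 named fact `descentToIntersection_printed` PROVED (assembly D4)

Topic `AlgebraicGeometry/ShimuraVarieties`, namespace `Literature.AlgebraicGeometry.ShimuraVarieties.UnitaryCanonicalModel`.
THEOREMS ONLY (no definition, no instance, no named fact).  Cell `hodgecm-mathlib` (D-0151), fan A rung A-I (binder `hDel`), row I-6
`descentToIntersection_printed` ([Deligne1971TravauxShimura] Prop. 5.10 with Lemme 5.10.1) — the `_holds` ASSEMBLY (crew map v3, lead
A-p08; harness pen ∕ D4 A-p03): every step is a landed tree theorem consumed BY NAME.

THE WIRING (A-p08 2026-08-28T07:03:01Z, seven steps).  Given the hDel datum, the complex tower `Sc`, finitely many number fields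
`Eᵢ ⊆ ℂ` containing `τ(L)` with forms `(Mᵢ, eᵢ)` carrying reciprocity (62) over `Eᵢ`, and `E = ⨅ Eᵢ`:
(2) HULL `E′ ⊇ Eᵢ` finite Galois over `ℚ` and the finite Galois layer `Lf := ↥(extendScalars (E ≤ E′))` over `↥E` with its
    middle inclusions `Eᵢ ↪ Lf`, subgroups `Hᵢ = Gal(Lf/Eᵢ ∩ E′)`, `⨆ Hᵢ = ⊤`, countability, extension `hext` and restriction
    `hres` of automorphisms (`FieldTheory/Galois/IntersectionHull`, P2 + P0);
(3) the twist predicate `Tw := ComplexRecordSystem.IsTwist Sc` on morphisms of the complex levels with uniqueness ∕ products ∕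
    naturality ∕ «the `eᵢ`-conjugate of `gal σ` is a twist» (`UnitaryShimuraComplexGaloisTwist`, Λ);
(5) reducedness ∕ separatedness ∕ projectivity ∕ finite type of the models over the compositum (`UnitaryShimuraFormProperties`);
(6) the GENERIC algebraic half: the `Gal(Lf/E)`-descent datum on `M_{i₀} ⊗ Lf` glued from the twists (`GaloisDescentTwist.exists_datum`,
    D1+D2+D3a over P3-gen + P4) and the descended functor with its complex form whose conjugated Galois automorphisms ARE the twists
    (D3b, `GaloisDescentDatumOfTwistsForm`);
(7) reciprocity (62) over `E` of the descended model = the point clause of the twists (`isCanonicalDescentOver_of_gal_twist`, P5).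
HC_CM is proved only modulo the 7 printed citations until rung 0 closes; with this file row I-6 is a THEOREM and `hDel` rests on the
hull's remaining printed inputs only.

## References
* [Deligne1971TravauxShimura] P. Deligne, *Travaux de Shimura*, Sém. Bourbaki 389 (1971), Prop. 5.10 (pp. 157–158) with Lemme 5.10.1
  (p. 158), Cor. 5.5 (p. 156).
* [Milne2005ShimuraVarieties] J. S. Milne, *Introduction to Shimura varieties* (2017 revision), Def. 12.8 (62) p. 114, Prop. 13.1 p. 117,
  Thm. 13.6 p. 118, Thm. 13.7 p. 119.
* [GortzWedhorn2020] U. Görtz, T. Wedhorn, *Algebraic Geometry I*, §(14.20), Thm. 14.83, Cor. 14.85 (Galois descent).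
-/

set_option autoImplicit false

noncomputable section

open Function MulAction Topology NumberField IsDedekindDomain CategoryTheory CategoryTheory.Limits Matrix
  AlgebraicGeometry Cardinal IntermediateField
open scoped Matrix ComplexOrder
open Literature.AlgebraicGeometry Literature.AlgebraicGeometry.Motives
open Literature.NumberTheory.Automorphic Literature.NumberTheory.Automorphic.UnitaryGroup
open Literature.NumberTheory.Automorphic.Liu2021.AppendixC (C5.OpenCompactSubgroup C5.SmallLevel)
open Literature.Geometry.ComplexHyperbolic Literature.Geometry.ComplexHyperbolic.BallModel
open Literature.NumberTheory.Automorphic.ShimuraDissection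
open Literature.FieldTheory.Galois

namespace Literature.AlgebraicGeometry.ShimuraVarieties.UnitaryCanonicalModel

open AbelianVariety (bcFunctor)
open GaloisDescentTwist

set_option backward.isDefEq.respectTransparency false

/-! ## The theorem -/

/-- **[Deligne1971TravauxShimura, Prop. 5.10] read at the unitary Shimura tower of `hDel` — PROVED**: models with Shimura reciprocity
(62) over finitely many number fields `Eᵢ ⊇ τ(L)` descend to a model with reciprocity over `E = ⨅ Eᵢ` (the named fact
`descentToIntersection_printed` of `UnitaryCanonicalModelDescentToIntersection`, row I-6).  Proof = Deligne's: Galois hull `E′`, the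
complex semilinear twists pinned by reciprocity on the special points (Λ: uniqueness by Zariski density of one Hecke orbit, Milne
Thm. 13.6), Galois descent of every level `M_{i₀} ⊗ E′` along `E′/E` with the descent datum glued from the twists over the generating
subgroups `Gal(E′/Eᵢ)` (Lemme 5.10.1; Görtz–Wedhorn Thm. 14.83), and reciprocity over `E` read off the descended twists.
[cite: Deligne1971TravauxShimura, Prop. 5.10 (pp. 157–158) with Lemme 5.10.1 (p. 158) and Cor. 5.5 (p. 156)]
[cite: Milne2005ShimuraVarieties, Def. 12.8 (62) p. 114, Thm. 13.6 p. 118 and Prop. 13.1 p. 117]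
[cite: GortzWedhorn2020, Thm. 14.83 and Cor. 14.85] -/
theorem descentToIntersection_printed_holds : descentToIntersection_printed := by
  intro L _ _ _ H τ T hT hpos hanis K₀ htf Sc ι _ _ Ei hfd hτ hforms E hE
  classical
  haveI : ∀ i, FiniteDimensional ℚ ↥(Ei i) := hfd
  -- (1) the forms
  choose M e hM using hforms
  obtain ⟨i₀⟩ := (inferInstance : Nonempty ι)
  subst hE
  -- (2) the hull `E'` and the finite Galois layer `Lf := E'` over `k := ⨅ Eᵢ`
  obtain ⟨E', hEE', hle, hfdE', hgalE'⟩ := Complex.exists_hull Ei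
  haveI := hfdE'
  haveI := hgalE'
  haveI := Complex.finiteDimensional_extendScalars_iInf Ei E' hEE'
  haveI := Complex.isGalois_extendScalars_iInf Ei E' hEE'
  -- the middle algebra structures `Eᵢ → Lf` (inclusions), towers to `ℂ`
  letI : ∀ i, Algebra ↥(Ei i) ↥(extendScalars hEE') := fun i =>
    (Complex.inclExtendScalars Ei E' hEE' hle i).toAlgebra
  haveI : ∀ i, IsScalarTower ↥(Ei i) ↥(extendScalars hEE') ℂ := fun i =>
    Complex.isScalarTower_inclExtendScalars Ei E' hEE' hle i
  -- the generating subgroups `Hᵢ = Gal(Lf/Eᵢ ∩ E′)`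
  have hHle : ∀ i, ∀ γ ∈ Complex.traceFixingSubgroup Ei E' hEE' i,
      ∀ x : ↥(Ei i), γ (algebraMap ↥(Ei i) ↥(extendScalars hEE') x) = algebraMap ↥(Ei i) ↥(extendScalars hEE') x :=
    fun i γ hγ x => (Complex.mem_traceFixingSubgroup_iff Ei E' hEE' hle i γ).1 hγ x
  have hH : ⨆ i, Complex.traceFixingSubgroup Ei E' hEE' i = ⊤ := Complex.iSup_traceFixingSubgroup_eq_top Ei E' hEE'
  -- (6) the generic algebraic half: descent datum on `M i₀ ⊗ Lf` glued from the twists (D3a over D1+D2, P3-gen, P4)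
  obtain ⟨D, hD⟩ := GaloisDescentTwist.exists_datum Sc.Mc (ComplexRecordSystem.IsTwist Sc) ↥(extendScalars hEE') M e i₀
    (fun γ => Complex.exists_ringEquiv_extends Ei E' hEE' γ)
    (fun K σ u v hu hv => hu.eq hv)
    (fun i K σ => ComplexRecordSystem.IsTwist.gal_transport Sc (Ei i) (hτ i) (M i) (e i) (hM i) K σ)
    (fun K σ ρ u v hu hv => hu.comp hv)
    (fun K K' f σ u u' hu hu' => hu.natural f hu')
    (Complex.traceFixingSubgroup Ei E' hEE') hHle
    (Complex.cardinalMk_extendScalars_le_aleph0 Ei E' hEE')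
    (fun i K => ComplexRecordSystem.isReduced_bc_compositum ↥(extendScalars hEE') Sc (M i) (e i) K)
    (fun i K => ComplexRecordSystem.isSeparated_compositum ↥(extendScalars hEE') Sc (M i) (e i) K)
    hH
    (fun K => ComplexRecordSystem.isProjectiveOver_compositum ↥(extendScalars hEE') Sc (M i₀) (e i₀) K)
    (fun K => ComplexRecordSystem.locallyOfFiniteType_compositum ↥(extendScalars hEE') Sc (M i₀) (e i₀) K)
  -- (6') the descended functor and its complex form, whose conjugated Galois automorphisms are twists (D3b)
  obtain ⟨X₀, e₀, htw⟩ := GaloisDescentTwist.exists_descended_form_tw Sc.Mc (ComplexRecordSystem.IsTwist Sc)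
    ↥(extendScalars hEE') M e i₀ D hD (fun σ => Complex.exists_algEquiv_restricts Ei E' hEE' σ)
  -- (7) reciprocity over `E = ⨅ Eᵢ` of the descended model (P5)
  exact ⟨X₀, e₀, ComplexRecordSystem.isCanonicalDescentOver_of_gal_twist Sc (⨅ i, Ei i) X₀ e₀
    (fun K σ s hs v₃ x₀ hx₀ d hd a => (htw K σ).2.2.2 s hs v₃ x₀ hx₀ d hd a)⟩

end Literature.AlgebraicGeometry.ShimuraVarieties.UnitaryCanonicalModel

end
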